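import Summits.HodgeConjecture.CorCM.QuarticCMTypeSlice
import HarnessLib

/-!
# The QUADRATIC slice of `HC_CM`: CM inside an imaginary quadratic field (powers and products of CM elliptic curves)

COR-CM (cell `pub-hodgecm2`), seat b24, count-neutral lane QUARTIC-SLICE, complement in degree `2` (same toolkit as
`CorCM/QuarticCMTypeSlice.lean`).  Everything is PROVED; theorems only; no definition; no named fact displayed.

`K` an imaginary quadratic field: `Hom(K, ℂ) = {a, ā}`, the two CM types are `{a}` and `{ā}`, both primitive and
nondegenerate (rank `2 = 1 + 1`, Ribet's bound `Pohlmann1968.isNondegenerate_of_isPrimitive_of_finrank_le_six`), the chosen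
realisation of `{ā}` is dominated by that of `{a}` (Deligne's twist), so every `∏_j A_{(K,Θ_j)}` is dominated by a power
`A_{\{a\}}^{n+1}`, on which the Hodge conjecture holds (`Pohlmann1968.IsNondegenerate.hodgeConjectureFor_pow`: the Hodge ring
of a power of a CM elliptic curve is generated by divisors).

* `eq_or_eq_conjugate_of_quadratic`, `mem_iff_eq_of_mem_quadratic`, `isPrimitive_of_quadratic`, `isNondegenerate_of_quadratic`;
* **`hodgeConjectureFor_cmProdAV_quadratic`** (every `∏_j A_{(K,Θ_j)}`, every realisation record, no hypothesis),
  `hodgeConjectureFor_of_avDominatedBy_cmProdAV_quadratic`, **`hodgeConjectureFor_of_isOfCMType_of_endAlgebra_quadratic`**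
  (every complex abelian variety of CM type whose simple abelian subvarieties have `End⁰ →+* K` — i.e. isogenous to a power of
  a CM elliptic curve with CM by `K`), **`cmAbelianHodge_slice_quadratic`** (the binders of `Theses.RankFourFaces.CMAbelianHodge`
  verbatim).  A classical case (Hodge ring of `Eⁿ` generated by divisors; Murasaki, Gordon §3), here in `HC_CM`'s binder
  language.

## References
* [Gordon1999HodgeAVSurvey] B. B. Gordon, *A survey of the Hodge conjecture for abelian varieties*, §3 and 10.10.
* [Ribet1980] K. Ribet, *Division fields of abelian varieties with complex multiplication*, Mém. SMF 2 (1980), (3.7).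
-/

noncomputable section

open CategoryTheory CategoryTheory.Limits NumberField NumberField.ComplexEmbedding AlgebraicGeometry
open Literature.AlgebraicGeometry Literature.AlgebraicGeometry.Motives Literature.AlgebraicGeometry.HodgeTheory
open Literature.AlgebraicGeometry.ComplexMultiplication Literature.AlgebraicGeometry.Milne1999
open Literature.AlgebraicGeometry.Pohlmann1968
open Literature.NumberTheory.ComplexMultiplication
open Literature.NumberTheory.ComplexMultiplication.CMTypeOps (bar mem_bar_iff conjugate_mem_iff_notMem
  mem_iff_conjugate_notMem)
open Literature.NumberTheory.Automorphic.PicardCM (cmRealisation CMAbelianVarietyRealised)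
open Summit.HodgeConjecture.CorCM.Domination
open Summit.HodgeConjecture.CorCM.CyclicSextic (exists_avDominatedBy_cmProdAV_of_isOfCMType_of_endAlgebra)

namespace Summit.HodgeConjecture.CorCM.QuarticCM

variable {K : Type} [Field K] [NumberField K] [IsCMField K]

/-! ## §1 The two embeddings and the two CM types of an imaginary quadratic field -/

/-- **`Hom(K, ℂ) = {a, ā}`** for an imaginary quadratic field. [folklore] -/
theorem eq_or_eq_conjugate_of_quadratic (h2 : Module.finrank ℚ K = 2) (a s : K →+* ℂ) : s = a ∨ s = conjugate a := by
  classical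
  by_contra h
  rw [not_or] at h
  have hcard : ({s, a, conjugate a} : Finset (K →+* ℂ)).card = 3 := by
    rw [Finset.card_insert_of_notMem (by simp [h.1, h.2]), Finset.card_pair (conjugate_ne a).symm]
  have hle : ({s, a, conjugate a} : Finset (K →+* ℂ)).card ≤ Fintype.card (K →+* ℂ) := Finset.card_le_univ _
  rw [hcard, Embeddings.card, h2] at hle
  exact absurd hle (by norm_num)

/-- **A CM type of an imaginary quadratic field is a singleton `{a}`.** [folklore] -/
theorem exists_mem_iff_eq_of_quadratic (h2 : Module.finrank ℚ K = 2) (Φ : CMType K) :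
    ∃ a : K →+* ℂ, ∀ s, s ∈ Φ.1 ↔ s = a := by
  obtain ⟨a₀⟩ : Nonempty (K →+* ℂ) := inferInstance
  obtain ⟨a, ha⟩ : ∃ a, a ∈ Φ.1 := by
    rcases CMTypeOps.mem_or_conjugate_mem Φ a₀ with h | h
    exacts [⟨a₀, h⟩, ⟨conjugate a₀, h⟩]
  refine ⟨a, fun s => ⟨fun hs => ?_, fun hs => hs ▸ ha⟩⟩
  rcases eq_or_eq_conjugate_of_quadratic h2 a s with h | h
  · exact h
  · exact absurd (h ▸ hs) ((mem_iff_conjugate_notMem Φ a).1 ha)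

/-- Every CM type of an imaginary quadratic field is `Φ` or `Φ̄`. [folklore] -/
theorem type_eq_or_eq_bar_of_quadratic (h2 : Module.finrank ℚ K = 2) (Φ Θ : CMType K) : Θ = Φ ∨ Θ = bar Φ := by
  obtain ⟨a, hΦ⟩ := exists_mem_iff_eq_of_quadratic h2 Φ
  have ha : a ∈ Φ.1 := (hΦ a).2 rfl
  have hna : conjugate a ∉ Φ.1 := (mem_iff_conjugate_notMem Φ a).1 ha
  by_cases hΘa : a ∈ Θ.1
  · refine Or.inl (Subtype.ext (Set.ext fun s => ?_))
    rcases eq_or_eq_conjugate_of_quadratic h2 a s with h | h <;> rw [h]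
    · exact iff_of_true hΘa ha
    · exact iff_of_false ((mem_iff_conjugate_notMem Θ a).1 hΘa) hna
  · refine Or.inr (Subtype.ext (Set.ext fun s => ?_))
    rw [mem_bar_iff]
    rcases eq_or_eq_conjugate_of_quadratic h2 a s with h | h <;> rw [h]
    · exact iff_of_false hΘa (not_not.2 ha)
    · exact iff_of_true ((conjugate_mem_iff_notMem Θ a).2 hΘa) hna

/-- **Every CM type of an imaginary quadratic field is primitive** (`a` and `ā` are separated by the identity).
[cite: Shimura1998, §8.2 Prop. 26] -/
theorem isPrimitive_of_quadratic (h2 : Module.finrank ℚ K = 2) (Φ : CMType K) (φ₀ : K →+* ℂ) :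
    IsPrimitive (ℂ ≃+* ℂ) Φ.1 φ₀ := by
  haveI := isPretransitive_ringEquiv_complex (K := K)
  obtain ⟨a, hΦ⟩ := exists_mem_iff_eq_of_quadratic h2 Φ
  have ha : a ∈ Φ.1 := (hΦ a).2 rfl
  have hna : conjugate a ∉ Φ.1 := (mem_iff_conjugate_notMem Φ a).1 ha
  rw [isPrimitive_iff_forall_eq]
  intro x y hxy
  have h1 := hxy 1
  simp only [one_smul] at h1
  rcases eq_or_eq_conjugate_of_quadratic h2 a x with hx | hx <;>
    rcases eq_or_eq_conjugate_of_quadratic h2 a y with hy | hy <;> rw [hx, hy] at h1 ⊢ <;>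
    first
    | rfl
    | (exfalso; tauto)

/-- **Every CM type of an imaginary quadratic field is nondegenerate** (rank `2 = 1 + 1`; Ribet's bound in degree `≤ 6`):
all powers of a CM elliptic curve have `B• = D•`. [cite: Ribet1980, (3.7)] -/
theorem isNondegenerate_of_quadratic (h2 : Module.finrank ℚ K = 2) (Φ : CMType K) : IsNondegenerate Φ := by
  obtain ⟨φ₀⟩ : Nonempty (K →+* ℂ) := inferInstance
  exact isNondegenerate_of_isPrimitive_of_finrank_le_six Φ (by rw [h2]; norm_num) φ₀ (isPrimitive_of_quadratic h2 Φ φ₀)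

/-! ## §2 The quadratic slice -/

/-- **HC for every `∏_j A_{(K,Θ_j)}` over an imaginary quadratic field `K`**, every finite family of CM types, every
realisation record, NO hypothesis: every factor is `A_Φ` or `A_{Φ̄} ≼ A_Φ` (`Φ = Θ 0`), so the product is dominated by
`A_Φ^{n+1}`, which satisfies HC (`Pohlmann1968.IsNondegenerate.hodgeConjectureFor_pow`). [cite: Gordon1999HodgeAVSurvey, §3 and 10.10] -/
theorem hodgeConjectureFor_cmProdAV_quadratic (h₃ : CMAbelianVarietyRealised) (h2 : Module.finrank ℚ K = 2) (n : ℕ)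
    (Θ : Fin (n + 1) → CMType K) : HodgeConjectureFor (cmProdAV K h₃ n Θ).dim (cmProdAV K h₃ n Θ).X := by
  refine hodgeConjectureFor_cmProdAV_of_forall_avDominatedBy h₃ Θ
    (fun _ : Fin 1 => (cmRealisation h₃ (cmCode K (Θ 0))).AV) (fun _ => 0) (fun j => ?_)
    ((isNondegenerate_of_quadratic h2 (Θ 0)).hodgeConjectureFor_pow (isCMTypeRealisation_cmCode K h₃ (Θ 0)) (n + 1))
  rcases type_eq_or_eq_bar_of_quadratic h2 (Θ 0) (Θ j) with h | h <;> rw [h]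
  · exact AVDominatedBy.refl _
  · exact avDominatedBy_cmAV_bar h₃ (Θ 0)

/-- **Everything dominated by some `∏_j A_{(K,Θ_j)}`, `K` imaginary quadratic, satisfies HC.** [cite: MumfordAV1970, §19] -/
theorem hodgeConjectureFor_of_avDominatedBy_cmProdAV_quadratic (h₃ : CMAbelianVarietyRealised)
    (h2 : Module.finrank ℚ K = 2) {A : AbelianVariety ℂ} {n : ℕ} {Θ : Fin (n + 1) → CMType K}
    (hA : AVDominatedBy A (cmProdAV K h₃ n Θ)) : HodgeConjectureFor A.dim A.X :=
  hodgeConjectureFor_of_avDominatedBy (hodgeConjectureFor_cmProdAV_quadratic h₃ h2 n Θ) hA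

/-- **THE QUADRATIC SLICE OF `HC_CM`.**  Every complex abelian variety OF CM TYPE all of whose simple abelian
subvarieties have `End⁰ →+* K`, `K` an imaginary quadratic field — i.e. every abelian variety isogenous to a power of a CM
elliptic curve with CM by `K` — satisfies the Hodge conjecture; UNCONDITIONAL (dimension `0`: the tree's HC in dimension
`≤ 3`; positive dimension: seat b30's record-free domination and §2). [cite: Gordon1999HodgeAVSurvey, §3 and 10.10]
[cite: Shimura1998, §5.1, §6.2 Theorem 3, §7.1 Proposition 7] -/
theorem hodgeConjectureFor_of_isOfCMType_of_endAlgebra_quadratic (h2 : Module.finrank ℚ K = 2) {A : AbelianVariety ℂ}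
    (hCM : IsOfCMType A)
    (hend : ∀ (B : AbelianVariety ℂ) (f : B ⟶ A), IsClosedImmersion (AbelianVariety.Hom.toSchemeHom f) →
      AbelianVariety.IsSimple B → 0 < B.dim → Nonempty (B.endAlgebra →+* K)) :
    HodgeConjectureFor A.dim A.X := by
  rcases Nat.eq_zero_or_pos A.dim with hA0 | hA0
  · exact hodgeConjectureFor_of_dim_le_three_holds (by omega) (AbelianVariety.isSmoothProjective_holds (A := A))
  · obtain ⟨n, Θ, hdom⟩ := exists_avDominatedBy_cmProdAV_of_isOfCMType_of_endAlgebra hA0 hCM hend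
    exact hodgeConjectureFor_of_avDominatedBy_cmProdAV_quadratic cmAbelianVarietyRealised_holds h2 hdom

/-- **`CMAbelianHodge` (= `HC_CM`) restricted to an imaginary quadratic field, binders VERBATIM, no further hypothesis.**
[cite: Gordon1999HodgeAVSurvey, §3 and 10.10] -/
theorem cmAbelianHodge_slice_quadratic (h2 : Module.finrank ℚ K = 2) :
    ∀ A : AbelianVariety ℂ, IsSmoothProjective A.dim A.X →
      (∃ S : Subalgebra ℚ A.endAlgebra,
        IsReduced ↥S ∧ (∀ x ∈ S, ∀ y ∈ S, x * y = y * x) ∧ Module.finrank ℚ ↥S = 2 * A.dim) →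
      (∀ (B : AbelianVariety ℂ) (f : B ⟶ A), IsClosedImmersion (AbelianVariety.Hom.toSchemeHom f) →
        AbelianVariety.IsSimple B → 0 < B.dim → Nonempty (B.endAlgebra →+* K)) →
      HodgeConjectureFor A.dim A.X :=
  fun _ _ hCM hend => hodgeConjectureFor_of_isOfCMType_of_endAlgebra_quadratic h2 hCM hend

end Summit.HodgeConjecture.CorCM.QuarticCM

end
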